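import Literature.IUT.LogThetaLattice.LatticeGlueOfKitsToy
import HarnessLib

/-!
# [IUTchIII] Prop 2.1 (vi): the Kummer square of the glue — reduced to ONE kit-level coherence at the real frame

Mochizuki, *Inter-universal Teichmüller Theory III*, kurims manuscript (May 2020), §2, Prop 2.1 (vi) pp.60–61
("natural isomorphisms `†F^{⊢×}_△ ⥲ †F^{⊢×}_{env}`, `F^{⊢×}_△(†D^⊢_△) ⥲ F^{⊢×}_{env}(†D_>)` … compatible with the Kummer
isomorphisms of (ii) above and Theorem 1.5, (iii)"), Thm 1.5 (iii) p.50 (final display), Cor 2.3 (iii) p.75; *II*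
(Dec 2020) Cor 4.10 (ii)(iv) pp.159–160. [claim: Mochizuki2012, status: disputed] (D-0012 claim key). PROOF-ONLY file
(no definition, nothing asserted about [IUTchIII]); abc-iut cell GAP-LEDGER row **G-w4d026-2** (owner abc-iut-L6-t3).

THE LAW. For a glue `G : LatticeGlue S` (`LatticeGlue.lean`) and a Hodge theater `X`, the *Prop 2.1 (vi) Kummer square*
is the equation of isomorphisms of `F^{⊢×μ}`-prime-strips `†F^{⊢×μ}_△ ⥲ F^{⊢×μ}_{env}(†D_>)`

  `(G.linkData.unitPortion .nonGaussian).app X ≪≫ G.pilotEnvFxm_iso.app X = G.kummerT.app X ≪≫ G.envNat.app (S.htToD.obj X)`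

(top route: the Frobenius-like `†F^{⊢×μ}_△ ⥲ †F^{⊢×μ}_{env}` of [IUTchII] Cor 4.10 (iv), then the `F^{⊢×μ}`-shadow of the
Kummer isomorphism `†F^⊩_{env} ⥲ F^⊩_{env}(†D_>)` of Prop 2.1 (ii); bottom route: the Kummer isomorphism
`†F^{⊢×μ}_△ ⥲ F^{⊢×μ}_△(†D^⊢_△)` of Thm 1.5 (iii), then the étale-like isomorphism of Prop 2.1 (vi)). abc-iut-w4-d022's
`LatticeGlueKummerCompatWitness.lean` proved it INDEPENDENT of the interface laws (`twoGlue` satisfies it, `twoGlueNeg`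
does not). This file says exactly WHAT the law is in terms of data, and decides it at the producers of record:

* §1 (any frame, any glue): the two routes UNFOLDED to the seven structure fields they are built from
  (`ThetaLinkData.unitPortion`, `LatticeGlue.pilotEnv_iso`, `ThetaMonoidData.kummerFgl` | `LatticeGlue.fxmDeltaHT_iso`,
  `BiCoricData.kummer`, `LatticeGlue.fxmDeltaD_iso`, `ThetaMonoidData.unitPortionD`) — `prop21vi_kummerSquare_iff_fields`;
  both routes are components of natural isomorphisms of functors `S.HT ⥤ S.Fxm`, so the law for all Hodge theaters is
  ONE EQUATION OF NATURAL ISOMORPHISMS `unitPortion ≪≫ pilotEnvFxm_iso = kummerT ≪≫ associator ≪≫ (htToD ◁ envNat)`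
  (`prop21vi_kummerSquare_forall_iff_natIso`); the square is TRANSPORTED along isomorphisms of Hodge theaters, so on a
  frame whose Hodge theaters are pairwise isomorphic it holds at every theater iff it holds at one
  (`prop21vi_kummerSquare_iff_of_iso`, `prop21vi_kummerSquare_forall_of_one`).
* §2 (the REAL frame `StripFrame.ofKits`, this seat's `LatticeGlue.ofKits` / `LatticeGlue.ofPassages`): the square at a
  Hodge theater of the frame is EQUIVALENT to the same square written with the KIT-LEVEL identifications of the
  `LatticeGlueKit` at the underlying representative (`LatticeGlue.ofKits_prop21vi_kummerSquare_iff`) — i.e. the wanted glue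
  law is precisely one named coherence between abc-iut-L6-t2's / abc-iut-L5's kit-level data (`ThetaLinkKit.unitPortion`,
  `LatticeGlueKit.pilotEnv_iso`, `ThetaMonoidKit.kummerFgl` vs `LatticeGlueKit.fxmDeltaHT_iso`, `BiCoricKit.kummer`,
  `LatticeGlueKit.fxmDeltaD_iso`, `ThetaMonoidKit.unitPortionD`), nothing more; and since the representative-level
  Hodge theaters are pairwise isomorphic under [IUTchI] Cor 5.3 (ii) (`HTRep.iso_nonempty`), one representative suffices
  (`LatticeGlue.ofKits_prop21vi_kummerSquare_forall_of_one`).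
* §3 (decision at the landed instance): over the toy kit stack (`KitsToy.latticeGlue`, p420737) the square HOLDS at every
  Hodge theater (`KitsToy.latticeGlue_prop21vi_kummerSquare`) — the toy `F^{⊢×μ}`-groupoid has one isomorphism between
  any two objects (abc-iut-w5-d132's `KitsToy.iso_eq_of_timesMuSide_Fxm`).
* §4 (what the law gives, stated with the law as an explicit hypothesis — no `Prop`-valued definition is introduced before
  the owner's successor structure): the Cor 2.3 (iii) form of the square on `RadialData`'s copies
  `F^{⊢×μ}_△(†D^⊢_△) ⥲ F^{⊢×μ}_{env}(†D_>)` (`LatticeGlue.envNatE`), "compatible with the Kummer isomorphisms of Prop 2.1 (ii) and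
  Thm 1.5 (iii)" (`cor23iii_kummerSquareE_of_kummerSquare`).

Honest framing: a consistency / reduction record for OUR typed interfaces; no side taken on [IUTchIII] Cor 3.12;
typed ≠ proved; the kit-level functors remain inputs BY NAME.
-/

namespace Literature.IUT.LogThetaLattice

open CategoryTheory
open Literature.IUT.HodgeTheaters Literature.IUT.HodgeTheaters.PMBaseKit
open Literature.IUT.HodgeArakelov
open AsSmallTransport

universe u v w

/-! ### 1. Any frame, any glue: the square in terms of the structure fields; one equation of natural isomorphisms -/

namespace LatticeGlue

variable {S : StripFrame.{u}} (G : LatticeGlue S)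

/-- **IUTchIII:Prop2.1(vi)** (kurims p.61) the TOP route `†F^{⊢×μ}_△ ⥲ †F^{⊢×μ}_{env} ⥲ F^{⊢×μ}_{env}(†D_>)` unfolded: the unit-portion
isomorphism of [IUTchII] Cor 4.10 (iv), then `F^{⊩▶×μ} ↦ F^{⊢×μ}` applied to the glue's `pilotEnv_iso` and to the Kummer
isomorphism `†F^⊩_{env} ⥲ F^⊩_{env}(†D_>)` of Prop 2.1 (ii). [claim: Mochizuki2012, status: disputed] -/
theorem prop21vi_topRoute_eq (X : S.HT) :
    (G.linkData.unitPortion LatticeKind.nonGaussian).app X ≪≫ G.pilotEnvFxm_iso.app X =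
      (G.linkData.unitPortion LatticeKind.nonGaussian).app X ≪≫
        S.FglxmToFxm.mapIso (G.pilotEnv_iso.app X) ≪≫
          S.FglxmToFxm.mapIso (S.FglToFglxm.mapIso (G.thetaMonoid.kummerFgl.app X)) :=
  Iso.ext rfl

/-- **IUTchIII:Thm1.5(iii)** (kurims p.50) the BOTTOM route `†F^{⊢×μ}_△ ⥲ F^{⊢×μ}_△(†D^⊢_△) ⥲ F^{⊢×μ}_{env}(†D_>)` unfolded: the glue's
`fxmDeltaHT_iso⁻¹`, `BiCores`' Kummer isomorphism of Thm 1.5 (iii), the glue's `fxmDeltaD_iso⁻¹`, `ThetaMonoids`' étale-like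
unit-portion isomorphism of Prop 2.1 (vi). [claim: Mochizuki2012, status: disputed] -/
theorem prop21vi_bottomRoute_eq (X : S.HT) :
    G.kummerT.app X ≪≫ G.envNat.app (S.htToD.obj X) =
      (G.fxmDeltaHT_iso.app X).symm ≪≫ G.biCoric.kummerAt X ≪≫
        (G.fxmDeltaD_iso.app (S.htToD.obj X)).symm ≪≫ G.thetaMonoid.unitPortionD.app (S.htToD.obj X) := by
  ext
  simp only [kummerT, envNat, BiCoricData.kummerAt, Iso.trans_hom, Iso.app_hom, Iso.symm_hom, Iso.app_inv,
    NatTrans.comp_app, Category.assoc]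
  rfl

/-- **IUTchIII:Prop2.1(vi)** (kurims p.61) **the Prop 2.1 (vi) Kummer square in terms of the data**: the square at `X` holds iff the
seven structure fields it is built from satisfy
`unitPortion ≫ (pilotEnv_iso)^{⊢×μ} ≫ (kummerFgl)^{⊢×μ} = fxmDeltaHT_iso⁻¹ ≫ kummer ≫ fxmDeltaD_iso⁻¹ ≫ unitPortionD` at `X` — the exact
shape of the coherence the GAP-LEDGER row G-w4d026-2 asks the owner to fix. [claim: Mochizuki2012, status: disputed] -/
theorem prop21vi_kummerSquare_iff_fields (X : S.HT) :
    (G.linkData.unitPortion LatticeKind.nonGaussian).app X ≪≫ G.pilotEnvFxm_iso.app X =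
        G.kummerT.app X ≪≫ G.envNat.app (S.htToD.obj X) ↔
      (G.linkData.unitPortion LatticeKind.nonGaussian).app X ≪≫
          S.FglxmToFxm.mapIso (G.pilotEnv_iso.app X) ≪≫
            S.FglxmToFxm.mapIso (S.FglToFglxm.mapIso (G.thetaMonoid.kummerFgl.app X)) =
        (G.fxmDeltaHT_iso.app X).symm ≪≫ G.biCoric.kummerAt X ≪≫
          (G.fxmDeltaD_iso.app (S.htToD.obj X)).symm ≪≫ G.thetaMonoid.unitPortionD.app (S.htToD.obj X) := by
  rw [prop21vi_topRoute_eq, prop21vi_bottomRoute_eq]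
  exact Iff.rfl

/-- **IUTchII:Cor4.10(iv)** (kurims p.160) the top route at `X` IS the component at `X` of ONE natural isomorphism of functors
`S.HT ⥤ S.Fxm`, `(†F^{⊩▶×μ}_△)^{⊢×μ} ≅ F^{⊢×μ}_{env}(†D_>(−))` ("functorial algorithm"): `unitPortion ≪≫ pilotEnvFxm_iso`.
[claim: Mochizuki2012, status: disputed] -/
theorem prop21vi_topRoute_eq_app (X : S.HT) :
    (G.linkData.unitPortion LatticeKind.nonGaussian).app X ≪≫ G.pilotEnvFxm_iso.app X =
      (G.linkData.unitPortion LatticeKind.nonGaussian ≪≫ G.pilotEnvFxm_iso).app X :=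
  Iso.ext rfl

/-- **IUTchIII:Thm1.5(iii)** (kurims p.50) the bottom route at `X` IS the component at `X` of ONE natural isomorphism
`†F^{⊢×μ}_△ ≅ F^{⊢×μ}_{env}(†D_>(−))`: `kummerT`, the associator, and `envNat` whiskered by `†HT ↦ †HT^D`.
[claim: Mochizuki2012, status: disputed] -/
theorem prop21vi_bottomRoute_eq_app (X : S.HT) :
    G.kummerT.app X ≪≫ G.envNat.app (S.htToD.obj X) =
      (G.kummerT ≪≫ Functor.associator S.htToD G.biCoric.dvDelta G.biCoric.fxmOfDv ≪≫
        Functor.isoWhiskerLeft S.htToD G.envNat).app X := by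
  have e : ∀ {A M C : S.Fxm} (k : A ⟶ M) (n : M ⟶ C), k ≫ n = k ≫ 𝟙 M ≫ n := fun k n => by
    simp only [Category.id_comp]
  ext
  simp only [Iso.trans_hom, Iso.app_hom, NatTrans.comp_app, Functor.associator_hom_app,
    Functor.isoWhiskerLeft_hom, Functor.whiskerLeft_app]
  exact e _ _

/-- **IUTchIII:Prop2.1(vi)** (kurims p.61) hence the Prop 2.1 (vi) Kummer square at `X` is the equality AT `X` of the two natural
isomorphisms `(†F^{⊩▶×μ}_△)^{⊢×μ} ≅ F^{⊢×μ}_{env}(†D_>(−))` (top) and `†F^{⊢×μ}_△ ≅ F^{⊢×μ}_{env}(†D_>(−))` (bottom).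
[claim: Mochizuki2012, status: disputed] -/
theorem prop21vi_kummerSquare_iff_app (X : S.HT) :
    (G.linkData.unitPortion LatticeKind.nonGaussian).app X ≪≫ G.pilotEnvFxm_iso.app X =
        G.kummerT.app X ≪≫ G.envNat.app (S.htToD.obj X) ↔
      (G.linkData.unitPortion LatticeKind.nonGaussian ≪≫ G.pilotEnvFxm_iso).app X =
        (G.kummerT ≪≫ Functor.associator S.htToD G.biCoric.dvDelta G.biCoric.fxmOfDv ≪≫
          Functor.isoWhiskerLeft S.htToD G.envNat).app X := by
  rw [prop21vi_topRoute_eq_app, prop21vi_bottomRoute_eq_app]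

/-- **IUTchIII:Prop2.1(vi)** (kurims p.61) **ONE EQUATION OF NATURAL ISOMORPHISMS**: the Prop 2.1 (vi) Kummer square holds at every
Hodge theater iff `unitPortion ≪≫ pilotEnvFxm_iso = kummerT ≪≫ (associator) ≪≫ (𝟙_{†HT ↦ †HT^D} ◫ envNat)` as isomorphisms of
functors `S.HT ⥤ S.Fxm` — the compact form of the law of GAP row G-w4d026-2. [claim: Mochizuki2012, status: disputed] -/
theorem prop21vi_kummerSquare_forall_iff_natIso :
    (∀ X : S.HT, (G.linkData.unitPortion LatticeKind.nonGaussian).app X ≪≫ G.pilotEnvFxm_iso.app X =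
        G.kummerT.app X ≪≫ G.envNat.app (S.htToD.obj X)) ↔
      G.linkData.unitPortion LatticeKind.nonGaussian ≪≫ G.pilotEnvFxm_iso =
        G.kummerT ≪≫ Functor.associator S.htToD G.biCoric.dvDelta G.biCoric.fxmOfDv ≪≫
          Functor.isoWhiskerLeft S.htToD G.envNat := by
  constructor
  · intro h
    ext X
    exact congrArg Iso.hom ((G.prop21vi_kummerSquare_iff_app X).mp (h X))
  · intro h X
    exact (G.prop21vi_kummerSquare_iff_app X).mpr (congrArg (fun e => Iso.app e X) h)

/-- **IUTchIII:Prop2.1(vi)** (kurims p.61) TRANSPORT: the Prop 2.1 (vi) Kummer square at `X` holds iff it holds at any isomorphic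
Hodge theater `Y` (both routes are components of natural isomorphisms; isomorphisms cancel).
[claim: Mochizuki2012, status: disputed] -/
theorem prop21vi_kummerSquare_iff_of_iso {X Y : S.HT} (ξ : X ≅ Y) :
    (G.linkData.unitPortion LatticeKind.nonGaussian).app X ≪≫ G.pilotEnvFxm_iso.app X =
        G.kummerT.app X ≪≫ G.envNat.app (S.htToD.obj X) ↔
      (G.linkData.unitPortion LatticeKind.nonGaussian).app Y ≪≫ G.pilotEnvFxm_iso.app Y =
        G.kummerT.app Y ≪≫ G.envNat.app (S.htToD.obj Y) := by
  rw [G.prop21vi_kummerSquare_iff_app X, G.prop21vi_kummerSquare_iff_app Y]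
  have hT := (G.linkData.unitPortion LatticeKind.nonGaussian ≪≫ G.pilotEnvFxm_iso).hom.naturality ξ.hom
  have hB := (G.kummerT ≪≫ Functor.associator S.htToD G.biCoric.dvDelta G.biCoric.fxmOfDv ≪≫
    Functor.isoWhiskerLeft S.htToD G.envNat).hom.naturality ξ.hom
  constructor
  · intro h
    have h' := congrArg Iso.hom h
    ext
    exact (cancel_epi ((G.linkData.pilotDelta ⋙ S.FglxmToFxm).map ξ.hom)).mp
      (hT.trans ((congrArg (fun t => t ≫ (S.htToD ⋙ G.fxmEnvD).map ξ.hom) h').trans hB.symm))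
  · intro h
    have h' := congrArg Iso.hom h
    ext
    exact (cancel_mono ((S.htToD ⋙ G.fxmEnvD).map ξ.hom)).mp
      (hT.symm.trans ((congrArg (fun t => (G.linkData.pilotDelta ⋙ S.FglxmToFxm).map ξ.hom ≫ t) h').trans hB))

/-- **IUTchIII:Prop2.1(vi)** (kurims p.61) ONE THEATER SUFFICES: if the Hodge theaters of the frame are pairwise isomorphic, the
Prop 2.1 (vi) Kummer square holds at every Hodge theater as soon as it holds at one. [claim: Mochizuki2012, status: disputed] -/
theorem prop21vi_kummerSquare_forall_of_one (hconn : ∀ X Y : S.HT, Nonempty (X ≅ Y)) (X₀ : S.HT)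
    (h₀ : (G.linkData.unitPortion LatticeKind.nonGaussian).app X₀ ≪≫ G.pilotEnvFxm_iso.app X₀ =
      G.kummerT.app X₀ ≪≫ G.envNat.app (S.htToD.obj X₀)) (X : S.HT) :
    (G.linkData.unitPortion LatticeKind.nonGaussian).app X ≪≫ G.pilotEnvFxm_iso.app X =
      G.kummerT.app X ≪≫ G.envNat.app (S.htToD.obj X) :=
  (G.prop21vi_kummerSquare_iff_of_iso (hconn X₀ X).some).mp h₀

/-! ### 4 (stated here, used in §3). What the law gives: the Cor 2.3 (iii) square on `RadialData`'s copies -/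

/-- **IUTchIII:Cor2.3(iii)** (kurims p.75) "isomorphisms `F^{⊢×μ}_△(†D^⊢_△) ⥲ F^{⊢×μ}_{env}(†D_>)` compatible with the Kummer isomorphisms of
Prop 2.1 (ii) [cf. also (vi)] and Thm 1.5 (iii)": GIVEN the Prop 2.1 (vi) Kummer square at `X` (explicit hypothesis — the
law of GAP row G-w4d026-2, not carried by `LatticeGlue` as landed), the comparison isomorphism `envNatE` on `RadialData`'s
objects (`ThetaCoricData.fxmDelta`, `ThetaCoricData.fxmEnv`) satisfies the same square, the copies being matched by the
glue's `fxmDeltaE_iso` / `fxmEnv_iso`. [claim: Mochizuki2012, status: disputed] -/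
theorem cor23iii_kummerSquareE_of_kummerSquare (X : S.HT)
    (hK : (G.linkData.unitPortion LatticeKind.nonGaussian).app X ≪≫ G.pilotEnvFxm_iso.app X =
      G.kummerT.app X ≪≫ G.envNat.app (S.htToD.obj X)) :
    ((G.linkData.unitPortion LatticeKind.nonGaussian).app X ≪≫ G.pilotEnvFxm_iso.app X) ≪≫
        (G.fxmEnv_iso.app (S.htToD.obj X)).symm =
      (G.kummerT.app X ≪≫ (G.fxmDeltaE_iso.app (S.htToD.obj X)).symm) ≪≫ G.envNatE.app (S.htToD.obj X) := by
  have alg : ∀ {A M Q C R : S.Fxm} (k : A ⟶ M) (n : M ⟶ C) (f : C ⟶ R) (e : Q ≅ M),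
      (k ≫ n) ≫ f = (k ≫ e.inv) ≫ (e.hom ≫ (n ≫ f)) := by
    intros
    simp only [Category.assoc, Iso.inv_hom_id_assoc]
  ext
  exact (congrArg (fun t => t ≫ G.fxmEnv_iso.inv.app (S.htToD.obj X)) (congrArg Iso.hom hK)).trans
    (alg _ _ _ (G.fxmDeltaE_iso.app (S.htToD.obj X)))

end LatticeGlue

/-! ### 2. The real frame: the square for `LatticeGlue.ofKits` IS the kit-level square -/

section Kit

variable {l : ℕ} {K : PMBaseKit.{u} l} {M : K.MultKit} {FK : K.FKit M}
  (L : FK.MonoLaws) (hbij : FK.IsomFtoDBijective) (hsurj : FK.IsomFmtoDmSurjective) (hR : FK.RlfOfIsStrip)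
  (X : TimesMuSide FK L)
  (h : ∀ A B : X.Fglxm, Function.Surjective (fun g : A ≅ B => (X.FglxmToFvtxm ⋙ X.FvtxmToFxm).mapIso g))
  (Gk : LatticeGlueKit hR X)

/-- **IUTchII:Cor4.10(iv)** (kurims p.160) over the real frame, the TOP route of the glued data `LatticeGlue.ofKits … Gk` at a Hodge theater,
read back in the kit's `F^{⊢×μ}`-groupoid (`AsSmall.down`), IS the kit-level top route at the underlying representative:
`ThetaLinkKit.unitPortion`, then `F^{⊩▶×μ} ↦ F^{⊢▶×μ} ↦ F^{⊢×μ}` of `LatticeGlueKit.pilotEnv_iso` and of `ThetaMonoidKit.kummerFgl`.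
[claim: Mochizuki2012, status: disputed] -/
theorem LatticeGlue.ofKits_prop21vi_topRoute_down (H : (StripFrame.ofKits L hbij hsurj hR X).HT) :
    AsSmall.down.mapIso
        (((LatticeGlue.ofKits L hbij hsurj hR X h Gk).linkData.unitPortion LatticeKind.nonGaussian).app H ≪≫
          (LatticeGlue.ofKits L hbij hsurj hR X h Gk).pilotEnvFxm_iso.app H) =
      (Gk.linkKit.unitPortion LatticeKind.nonGaussian).app (ULift.down H) ≪≫
        (X.FglxmToFvtxm ⋙ X.FvtxmToFxm).mapIso (Gk.pilotEnv_iso.app (ULift.down H)) ≪≫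
          (X.FglxmToFvtxm ⋙ X.FvtxmToFxm).mapIso
            (X.FglToFglxm.mapIso (Gk.thetaMonoidKit.kummerFgl.app (ULift.down H))) :=
  Iso.ext rfl

/-- **IUTchIII:Thm1.5(iii)** (kurims p.50) over the real frame, the BOTTOM route of `LatticeGlue.ofKits … Gk` at a Hodge theater, read back in
the kit's `F^{⊢×μ}`-groupoid, IS the kit-level bottom route: `LatticeGlueKit.fxmDeltaHT_iso⁻¹`, `BiCoricKit.kummer`,
`LatticeGlueKit.fxmDeltaD_iso⁻¹`, `ThetaMonoidKit.unitPortionD` at the underlying representatives. [claim: Mochizuki2012, status: disputed] -/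
theorem LatticeGlue.ofKits_prop21vi_bottomRoute_down (H : (StripFrame.ofKits L hbij hsurj hR X).HT) :
    AsSmall.down.mapIso
        ((LatticeGlue.ofKits L hbij hsurj hR X h Gk).kummerT.app H ≪≫
          (LatticeGlue.ofKits L hbij hsurj hR X h Gk).envNat.app ((StripFrame.ofKits L hbij hsurj hR X).htToD.obj H)) =
      ((Gk.fxmDeltaHT_iso.app (ULift.down H)).symm ≪≫ Gk.biCoricKit.kummer.app (ULift.down H)) ≪≫
        ((Gk.fxmDeltaD_iso.app (HTRep.toDFunctor.obj (ULift.down H))).symm ≪≫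
          Gk.thetaMonoidKit.unitPortionD.app (HTRep.toDFunctor.obj (ULift.down H))) :=
  Iso.ext rfl

/-- **IUTchIII:Prop2.1(vi)** (kurims p.61) **G-w4d026-2 AT THE REAL FRAME.** For the glued [IUTchIII] §1–§2 data `LatticeGlue.ofKits … Gk` over
`StripFrame.ofKits L hbij hsurj hR X`, the Prop 2.1 (vi) Kummer square at a Hodge theater `H` holds IF AND ONLY IF the
KIT-LEVEL identifications of `Gk` satisfy the same square at the underlying representative `ULift.down H`:
`unitPortion ≫ (pilotEnv_iso)^{⊢×μ} ≫ (kummerFgl)^{⊢×μ} = (fxmDeltaHT_iso⁻¹ ≫ kummer) ≫ (fxmDeltaD_iso⁻¹ ≫ unitPortionD)` — the wanted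
glue law is exactly this one coherence between the kit-level data (inputs BY NAME, owners abc-iut-L6-t2 / abc-iut-L5),
nothing on the [IUTchIII] side. [claim: Mochizuki2012, status: disputed] -/
theorem LatticeGlue.ofKits_prop21vi_kummerSquare_iff (H : (StripFrame.ofKits L hbij hsurj hR X).HT) :
    ((LatticeGlue.ofKits L hbij hsurj hR X h Gk).linkData.unitPortion LatticeKind.nonGaussian).app H ≪≫
          (LatticeGlue.ofKits L hbij hsurj hR X h Gk).pilotEnvFxm_iso.app H =
        (LatticeGlue.ofKits L hbij hsurj hR X h Gk).kummerT.app H ≪≫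
          (LatticeGlue.ofKits L hbij hsurj hR X h Gk).envNat.app ((StripFrame.ofKits L hbij hsurj hR X).htToD.obj H) ↔
      (Gk.linkKit.unitPortion LatticeKind.nonGaussian).app (ULift.down H) ≪≫
          (X.FglxmToFvtxm ⋙ X.FvtxmToFxm).mapIso (Gk.pilotEnv_iso.app (ULift.down H)) ≪≫
            (X.FglxmToFvtxm ⋙ X.FvtxmToFxm).mapIso
              (X.FglToFglxm.mapIso (Gk.thetaMonoidKit.kummerFgl.app (ULift.down H))) =
        ((Gk.fxmDeltaHT_iso.app (ULift.down H)).symm ≪≫ Gk.biCoricKit.kummer.app (ULift.down H)) ≪≫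
          ((Gk.fxmDeltaD_iso.app (HTRep.toDFunctor.obj (ULift.down H))).symm ≪≫
            Gk.thetaMonoidKit.unitPortionD.app (HTRep.toDFunctor.obj (ULift.down H))) := by
  rw [← LatticeGlue.ofKits_prop21vi_topRoute_down L hbij hsurj hR X h Gk H,
    ← LatticeGlue.ofKits_prop21vi_bottomRoute_down L hbij hsurj hR X h Gk H]
  exact ⟨fun e => congrArg _ e, fun e => (isoEquiv _ _).injective e⟩

/-- **IUTchIII:Prop2.1(vi)** (kurims p.61) … and since any two representative-level `Θ^{±ell}NF`-Hodge theaters over the kits are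
isomorphic under [IUTchI] Cor 5.3 (ii) (`HTRep.iso_nonempty hbij`), the Prop 2.1 (vi) Kummer square for
`LatticeGlue.ofKits … Gk` holds at EVERY Hodge theater of the real frame as soon as the kit-level square holds at ONE
representative `H₀`. [claim: Mochizuki2012, status: disputed] -/
theorem LatticeGlue.ofKits_prop21vi_kummerSquare_forall_of_one (H₀ : HTRep FK)
    (h₀ : (Gk.linkKit.unitPortion LatticeKind.nonGaussian).app H₀ ≪≫
          (X.FglxmToFvtxm ⋙ X.FvtxmToFxm).mapIso (Gk.pilotEnv_iso.app H₀) ≪≫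
            (X.FglxmToFvtxm ⋙ X.FvtxmToFxm).mapIso (X.FglToFglxm.mapIso (Gk.thetaMonoidKit.kummerFgl.app H₀)) =
        ((Gk.fxmDeltaHT_iso.app H₀).symm ≪≫ Gk.biCoricKit.kummer.app H₀) ≪≫
          ((Gk.fxmDeltaD_iso.app (HTRep.toDFunctor.obj H₀)).symm ≪≫
            Gk.thetaMonoidKit.unitPortionD.app (HTRep.toDFunctor.obj H₀)))
    (H : (StripFrame.ofKits L hbij hsurj hR X).HT) :
    ((LatticeGlue.ofKits L hbij hsurj hR X h Gk).linkData.unitPortion LatticeKind.nonGaussian).app H ≪≫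
        (LatticeGlue.ofKits L hbij hsurj hR X h Gk).pilotEnvFxm_iso.app H =
      (LatticeGlue.ofKits L hbij hsurj hR X h Gk).kummerT.app H ≪≫
        (LatticeGlue.ofKits L hbij hsurj hR X h Gk).envNat.app ((StripFrame.ofKits L hbij hsurj hR X).htToD.obj H) :=
  (LatticeGlue.ofKits L hbij hsurj hR X h Gk).prop21vi_kummerSquare_forall_of_one
    (iso_nonempty_lift (HTRep.iso_nonempty hbij)) (AsSmall.up.obj H₀)
    ((LatticeGlue.ofKits_prop21vi_kummerSquare_iff L hbij hsurj hR X h Gk (AsSmall.up.obj H₀)).mpr h₀) H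

end Kit

/-! ### 2b. Over `TimesMuSide.ofPassages` (no [IUTchII]-side hypothesis) -/

section OfPassages

variable {l : ℕ} {K : PMBaseKit.{max (v + 1) w} l} {M : K.MultKit} {FK : K.FKit M}
  {P : PlaceData K.V} {Gp : K.V → Type} [∀ v, Group (Gp v)]
  {Xu : ∀ v, GroupTheoreticUnits.{0, w} (Gp v)}
  {S₀ : FVdashSplitTriMuPrimeStrip.{0, v, w} P Gp Xu}
  (L : FK.MonoLaws) (hbij : FK.IsomFtoDBijective) (hsurj : FK.IsomFmtoDmSurjective) (hR : FK.RlfOfIsStrip)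
  (Ps : TimesMuPassages FK S₀) (Gk : LatticeGlueKit hR (TimesMuSide.ofPassages L hR Ps))

/-- **IUTchIII:Prop2.1(vi)** (kurims p.61) the same reduction over abc-iut-L6-t2's print-level strip groupoids (`LatticeGlue.ofPassages`):
the Prop 2.1 (vi) Kummer square at a Hodge theater ↔ the kit-level square at the underlying representative.
[claim: Mochizuki2012, status: disputed] -/
theorem LatticeGlue.ofPassages_prop21vi_kummerSquare_iff
    (H : (StripFrame.ofKits L hbij hsurj hR (TimesMuSide.ofPassages L hR Ps)).HT) :
    ((LatticeGlue.ofPassages L hbij hsurj hR Ps Gk).linkData.unitPortion LatticeKind.nonGaussian).app H ≪≫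
          (LatticeGlue.ofPassages L hbij hsurj hR Ps Gk).pilotEnvFxm_iso.app H =
        (LatticeGlue.ofPassages L hbij hsurj hR Ps Gk).kummerT.app H ≪≫
          (LatticeGlue.ofPassages L hbij hsurj hR Ps Gk).envNat.app
            ((StripFrame.ofKits L hbij hsurj hR (TimesMuSide.ofPassages L hR Ps)).htToD.obj H) ↔
      (Gk.linkKit.unitPortion LatticeKind.nonGaussian).app (ULift.down H) ≪≫
          ((TimesMuSide.ofPassages L hR Ps).FglxmToFvtxm ⋙ (TimesMuSide.ofPassages L hR Ps).FvtxmToFxm).mapIso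
            (Gk.pilotEnv_iso.app (ULift.down H)) ≪≫
            ((TimesMuSide.ofPassages L hR Ps).FglxmToFvtxm ⋙ (TimesMuSide.ofPassages L hR Ps).FvtxmToFxm).mapIso
              ((TimesMuSide.ofPassages L hR Ps).FglToFglxm.mapIso
                (Gk.thetaMonoidKit.kummerFgl.app (ULift.down H))) =
        ((Gk.fxmDeltaHT_iso.app (ULift.down H)).symm ≪≫ Gk.biCoricKit.kummer.app (ULift.down H)) ≪≫
          ((Gk.fxmDeltaD_iso.app (HTRep.toDFunctor.obj (ULift.down H))).symm ≪≫
            Gk.thetaMonoidKit.unitPortionD.app (HTRep.toDFunctor.obj (ULift.down H))) :=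
  LatticeGlue.ofKits_prop21vi_kummerSquare_iff L hbij hsurj hR _ _ Gk H

end OfPassages

/-! ### 3. Decision at the landed instance: the toy kit stack -/

namespace KitsToy

variable (l : ℕ) [Fact l.Prime] (hl : l ≠ 2)

/-- **IUTchIII:Prop2.1(vi)** (kurims p.61) over the toy glue `KitsToy.latticeGlue` (the glued §1–§2 data assembled by `LatticeGlue.ofKits` from
abc-iut-L5-t4's toy kits, p420737) the Prop 2.1 (vi) Kummer square HOLDS at every Hodge theater: by §2 it is the kit-level
square, an equation between two isomorphisms of the toy `F^{⊢×μ}`-groupoid, which has exactly one isomorphism between any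
two objects (`KitsToy.iso_eq_of_timesMuSide_Fxm`). Toy-class consistency witness; nothing about real Hodge theaters.
[claim: Mochizuki2012, status: disputed] -/
theorem latticeGlue_prop21vi_kummerSquare (X : (frame l hl).HT) :
    ((latticeGlue l hl).linkData.unitPortion LatticeKind.nonGaussian).app X ≪≫ (latticeGlue l hl).pilotEnvFxm_iso.app X =
      (latticeGlue l hl).kummerT.app X ≪≫ (latticeGlue l hl).envNat.app ((frame l hl).htToD.obj X) :=
  (LatticeGlue.ofKits_prop21vi_kummerSquare_iff (FKit.MonoLaws.toy l hl) (FKit.isomFtoDBijective_toy l hl)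
      (FKit.isomFmtoDmSurjective_toy l hl) (FKit.rlfOfIsStrip_toy l hl) (timesMuSide l hl)
      (fglxmToFxm_mapIso_surjective l hl) (latticeGlueKit l hl) X).mpr
    (iso_eq_of_timesMuSide_Fxm l hl _ _)

/-- **IUTchIII:Cor2.3(iii)** (kurims p.75) hence over the toy glue the Cor 2.3 (iii) square on `RadialData`'s copies holds as well (§4
applied to §3). [claim: Mochizuki2012, status: disputed] -/
theorem latticeGlue_cor23iii_kummerSquareE (X : (frame l hl).HT) :
    (((latticeGlue l hl).linkData.unitPortion LatticeKind.nonGaussian).app X ≪≫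
          (latticeGlue l hl).pilotEnvFxm_iso.app X) ≪≫
        ((latticeGlue l hl).fxmEnv_iso.app ((frame l hl).htToD.obj X)).symm =
      ((latticeGlue l hl).kummerT.app X ≪≫ ((latticeGlue l hl).fxmDeltaE_iso.app ((frame l hl).htToD.obj X)).symm) ≪≫
        (latticeGlue l hl).envNatE.app ((frame l hl).htToD.obj X) :=
  (latticeGlue l hl).cor23iii_kummerSquareE_of_kummerSquare X (latticeGlue_prop21vi_kummerSquare l hl X)

end KitsToy

end Literature.IUT.LogThetaLattice
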